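import Mathlib
import Literature.NumberTheory.Automorphic.ResGLnConeDictionaryCone
import Literature.NumberTheory.Automorphic.ArchimedeanCalculus
import HarnessLib

/-!
# The exterior derivative on the hermitian cone along left-invariant curves —
crux `HeckeEigenvalueField` (stmt-Langlands-13632), line `Sketch`, stub LIFT-D

Namespace `Summit.Langlands.Langlands.Theorems.HeckeEigenvalueField.Res`.  Theorems only.
Let `G_∞ = GL_n(K_∞)` (`(AutomorphyDatum.gl n K hcpt).arch`), `X = ResGLnCone.hermSpace n K` the
real space of hermitian matrices, `sq h = h hᴴ` the hermitian square and
`tg h Y = h Y hᴴ + h Yᴴ hᴴ` its differential on the left-invariant field of `Y ∈ 𝔤𝔩_n(K_∞)`.  For a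
form `β : X → X [⋀^Fin q]→L[ℝ] V` differentiable at `sq g` and HERMITIAN `Y₀, …, Y_q`,
`stub_extDeriv_hermSquare_leftInvariant` proves
`dβ(g gᴴ)(tg g Y₀, …, tg g Y_q) = ∑ᵢ (-1)ⁱ d/dt|₀ [β(sq (g e^{tYᵢ}))(…, tg (g e^{tYᵢ}) Y_l, …)_{l ≠ i}]`,
the invariant formula for `d(sq^* β)` on left-invariant fields in which the bracket terms vanish:
along `g e^{tYᵢ}` the vector `tg (g e^{tYᵢ}) Y_l` has `t`-derivative `2 g (Yᵢ Y_l + Y_l Yᵢ) gᴴ` at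
`0`, SYMMETRIC in `(i, l)`, and symmetric slot terms cancel in the signed Leibniz sum (pair
involution adapted from the Maurer–Cartan stub `…StubDictW2`); the first-order terms are Mathlib's
`extDeriv`.  Matrix calculus in the operator norm (section `MatrixCalculus`): `t ↦ g exp(tX)` has
derivative `g X` (`hasDerivAt_exp_smul_const'`), product rule, conjugate transpose and hermitian-part
retraction as continuous linear maps; plus the one-variable Leibniz rule for `t ↦ f t (v₁ t, …)`
(`HasFDerivAt.continuousAlternatingMap_apply`).  Companion of `ConeDictionary.coneForm_apply_tangent`.
Reference: A. Borel, N. Wallach, *Continuous cohomology, discrete subgroups, and representations of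
reductive groups*, 2nd ed. (2000), I §1, VII 2.2–2.5. [BorelWallach2000]
-/

set_option linter.dupNamespace false -- project-wide: `Summit.Langlands.Langlands` is the mandated namespace

noncomputable section

-- as in `ArchBigCellDerivatives`: product-topology vs normed instance paths on `M_n(K_∞)` unfold `Matrix`
set_option backward.isDefEq.respectTransparency false

open scoped Topology Classical Matrix
open Filter NumberField NumberField.mixedEmbedding
open Literature.NumberTheory.Automorphic Literature.NumberTheory.Automorphic.RealMatrixGroup

namespace Summit.Langlands.Langlands.Theorems.HeckeEigenvalueField.Res

-- adapted from `…HeckeEigenvalueFieldStubDictW2.lean` (private there)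
/-- The integer sign `(-1 : ℤ) ^ m` acting on a module is the scalar sign `(-1 : R) ^ m`. [folklore] -/
private theorem liftD_neg_one_pow_zsmul_eq {R V : Type*} [Ring R] [AddCommGroup V] [Module R V]
    (m : ℕ) (y : V) : ((-1 : ℤ) ^ m) • y = ((-1 : R) ^ m) • y := by
  rw [← Int.cast_smul_eq_zsmul R]
  simp

-- adapted from `…HeckeEigenvalueFieldStubDictW2.lean` (private there)
/-- Folding a sum over ordered pairs of distinct indices `(i, i.succAbove j)` onto increasing pairs
with the involution `(i, j) ↦ (i.succAbove j, j.predAbove i)`. [folklore] -/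
private theorem liftD_sum_sum_eq_sum_sum_ite_add {N : Type*} [AddCommMonoid N] {n : ℕ}
    (F : Fin (n + 2) → Fin (n + 1) → N) :
    ∑ i : Fin (n + 2), ∑ j : Fin (n + 1), F i j =
      ∑ i : Fin (n + 2), ∑ j : Fin (n + 1),
        if (i : ℕ) < ((i.succAbove j : Fin (n + 2)) : ℕ) then
          F i j + F (i.succAbove j) (j.predAbove i) else 0 := by
  let τ : Fin (n + 2) × Fin (n + 1) → Fin (n + 2) × Fin (n + 1) := fun p =>
    (p.1.succAbove p.2, p.2.predAbove p.1)
  have hτ : Function.Involutive τ := fun p =>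
    Prod.ext (Fin.succAbove_succAbove_predAbove p.1 p.2) (Fin.predAbove_predAbove_succAbove p.1 p.2)
  have hPτ : ∀ p : Fin (n + 2) × Fin (n + 1),
      (((τ p).1 : ℕ) < (((τ p).1.succAbove (τ p).2 : Fin (n + 2)) : ℕ)) ↔
        ¬ ((p.1 : ℕ) < ((p.1.succAbove p.2 : Fin (n + 2)) : ℕ)) := by
    intro p
    simp only [τ, Fin.succAbove_succAbove_predAbove]
    have h := Fin.val_ne_of_ne (Fin.succAbove_ne p.1 p.2)
    omega
  rw [← Fintype.sum_prod_type', ← Fintype.sum_prod_type']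
  calc ∑ p : Fin (n + 2) × Fin (n + 1), F p.1 p.2
      = ∑ p : Fin (n + 2) × Fin (n + 1),
          ((if (p.1 : ℕ) < ((p.1.succAbove p.2 : Fin (n + 2)) : ℕ) then F p.1 p.2 else 0) +
            (if (p.1 : ℕ) < ((p.1.succAbove p.2 : Fin (n + 2)) : ℕ) then 0 else F p.1 p.2)) :=
        Finset.sum_congr rfl fun p _ => by split_ifs <;> simp
    _ = (∑ p : Fin (n + 2) × Fin (n + 1),
          if (p.1 : ℕ) < ((p.1.succAbove p.2 : Fin (n + 2)) : ℕ) then F p.1 p.2 else 0) +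
          ∑ p : Fin (n + 2) × Fin (n + 1),
            if (p.1 : ℕ) < ((p.1.succAbove p.2 : Fin (n + 2)) : ℕ) then 0 else F p.1 p.2 :=
        Finset.sum_add_distrib
    _ = (∑ p : Fin (n + 2) × Fin (n + 1),
          if (p.1 : ℕ) < ((p.1.succAbove p.2 : Fin (n + 2)) : ℕ) then F p.1 p.2 else 0) +
          ∑ p : Fin (n + 2) × Fin (n + 1),
            if ((τ p).1 : ℕ) < (((τ p).1.succAbove (τ p).2 : Fin (n + 2)) : ℕ) then 0
            else F (τ p).1 (τ p).2 := by
        congr 1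
        exact (Fintype.sum_equiv hτ.toPerm _ _ fun p => rfl).symm
    _ = (∑ p : Fin (n + 2) × Fin (n + 1),
          if (p.1 : ℕ) < ((p.1.succAbove p.2 : Fin (n + 2)) : ℕ) then F p.1 p.2 else 0) +
          ∑ p : Fin (n + 2) × Fin (n + 1),
            if (p.1 : ℕ) < ((p.1.succAbove p.2 : Fin (n + 2)) : ℕ) then F (τ p).1 (τ p).2
            else 0 := by
        congr 1
        refine Finset.sum_congr rfl fun p _ => ?_
        rw [if_congr (hPτ p) rfl rfl, ite_not]
    _ = ∑ p : Fin (n + 2) × Fin (n + 1),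
          ((if (p.1 : ℕ) < ((p.1.succAbove p.2 : Fin (n + 2)) : ℕ) then F p.1 p.2 else 0) +
            (if (p.1 : ℕ) < ((p.1.succAbove p.2 : Fin (n + 2)) : ℕ) then F (τ p).1 (τ p).2
              else 0)) := Finset.sum_add_distrib.symm
    _ = _ := Finset.sum_congr rfl fun p _ => by split_ifs <;> simp [τ]

-- adapted from `…HeckeEigenvalueFieldStubDictW2.lean` (private there)
/-- The signed sum over `i` of the Leibniz slot terms `f (X ∘ i.succAbove with -B i k in the slot of
k = i.succAbove j)` of an alternating form equals the Chevalley–Eilenberg sum over increasing pairs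
`i < k` of `(-1)^{i+k} f (B i k - B k i, X with i and k removed)`. [folklore] -/
private theorem liftD_sum_smul_sum_map_update_eq {R M N : Type*} [CommRing R] [AddCommGroup M]
    [Module R M] [AddCommGroup N] [Module R N] {n : ℕ} (f : M [⋀^Fin (n + 1)]→ₗ[R] N)
    (X : Fin (n + 2) → M) (B : Fin (n + 2) → Fin (n + 2) → M) :
    ∑ i : Fin (n + 2), (-1 : R) ^ (i : ℕ) • ∑ j : Fin (n + 1),
        f (Function.update (fun l => X (i.succAbove l)) j (-(B i (i.succAbove j)))) =
      ∑ i : Fin (n + 2), ∑ j : Fin (n + 1),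
        if (i : ℕ) < ((i.succAbove j : Fin (n + 2)) : ℕ) then
          ((-1 : R) ^ ((i : ℕ) + ((i.succAbove j : Fin (n + 2)) : ℕ))) •
            f (Fin.cons (B i (i.succAbove j) - B (i.succAbove j) i)
              (fun l => X (i.succAbove (j.succAbove l))))
        else 0 := by
  have h1 : ∀ (i : Fin (n + 2)) (j : Fin (n + 1)) (w : M),
      f (Function.update (fun l => X (i.succAbove l)) j w) =
        (-1 : R) ^ (j : ℕ) • f (Fin.cons w (fun l => X (i.succAbove (j.succAbove l)))) := by
    intro i j w
    rw [← Fin.insertNth_removeNth, AlternatingMap.map_insertNth, liftD_neg_one_pow_zsmul_eq (R := R)]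
    rfl
  have hneg : ∀ (w : M) (r : Fin n → M), f (Fin.cons (-w) r) = -f (Fin.cons w r) := by
    intro w r
    have := f.map_vecCons_smul r (-1) w
    simpa [Matrix.vecCons] using this
  have hsub : ∀ (w w' : M) (r : Fin n → M),
      f (Fin.cons (w - w') r) = f (Fin.cons w r) - f (Fin.cons w' r) := by
    intro w w' r
    have := f.map_vecCons_add r w (-w')
    simpa [Matrix.vecCons, sub_eq_add_neg, hneg] using this
  calc (∑ i : Fin (n + 2), (-1 : R) ^ (i : ℕ) • ∑ j : Fin (n + 1),
        f (Function.update (fun l => X (i.succAbove l)) j (-(B i (i.succAbove j)))))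
      = ∑ i : Fin (n + 2), ∑ j : Fin (n + 1), (-1 : R) ^ ((i : ℕ) + (j : ℕ) + 1) •
          f (Fin.cons (B i (i.succAbove j)) (fun l => X (i.succAbove (j.succAbove l)))) := by
        refine Finset.sum_congr rfl fun i _ => ?_
        rw [Finset.smul_sum]
        refine Finset.sum_congr rfl fun j _ => ?_
        rw [h1, hneg, smul_neg, smul_neg, ← neg_smul, smul_smul]
        congr 1
        ring
    _ = _ := by
        rw [liftD_sum_sum_eq_sum_sum_ite_add]
        refine Finset.sum_congr rfl fun i _ => Finset.sum_congr rfl fun j _ => ?_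
        split_ifs with hij
        · have hij' : i < i.succAbove j := Fin.lt_def.mpr hij
          have hle : i ≤ Fin.castSucc j := (Fin.lt_succAbove_iff_le_castSucc i j).mp hij'
          have hk : ((i.succAbove j : Fin (n + 2)) : ℕ) = (j : ℕ) + 1 := by
            rw [Fin.succAbove_of_le_castSucc _ _ hle, Fin.val_succ]
          have hj' : ((j.predAbove i : Fin (n + 1)) : ℕ) = (i : ℕ) := by
            rw [Fin.predAbove_of_le_castSucc _ _ hle, Fin.coe_castPred]
          simp only [Fin.succAbove_succAbove_predAbove,
            Fin.succAbove_succAbove_succAbove_predAbove, hk, hj', hsub, smul_sub]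
          have e1 : (-1 : R) ^ ((j : ℕ) + 1 + (i : ℕ) + 1) = -(-1) ^ ((i : ℕ) + ((j : ℕ) + 1)) := by ring
          have e2 : (-1 : R) ^ ((i : ℕ) + (j : ℕ) + 1) = (-1) ^ ((i : ℕ) + ((j : ℕ) + 1)) := by ring
          rw [e1, e2, neg_smul, sub_eq_add_neg]
        · rfl

/-- **Symmetric slot terms cancel in the signed Leibniz sum.**  For an alternating `q`-form `f`,
a tuple `w : Fin (q+1) → M` and a SYMMETRIC family `u a b = u b a`, the signed sum over `i` of the
Leibniz slot terms `f (w ∘ i.succAbove with u i k in the slot of k = i.succAbove j)` vanishes: the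
ordered pairs `(i, k)` and `(k, i)` contribute `± f (u i k, …)` (`liftD_sum_smul_sum_map_update_eq`
with `B = -u`: every commutator `B i k - B k i` vanishes). [folklore] -/
theorem sum_neg_one_pow_smul_sum_map_update_eq_zero_of_symm {R M N : Type*} [CommRing R]
    [AddCommGroup M] [Module R M] [AddCommGroup N] [Module R N] {q : ℕ}
    (f : M [⋀^Fin q]→ₗ[R] N) (w : Fin (q + 1) → M) (u : Fin (q + 1) → Fin (q + 1) → M)
    (hu : ∀ a b, u a b = u b a) :
    ∑ i : Fin (q + 1), (-1 : R) ^ (i : ℕ) • ∑ j : Fin q,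
        f (Function.update (fun l => w (i.succAbove l)) j (u i (i.succAbove j))) = 0 := by
  cases q with
  | zero => simp
  | succ n =>
    have h := liftD_sum_smul_sum_map_update_eq f w (fun a b => -u a b)
    simp only [neg_neg] at h
    rw [h]
    refine Finset.sum_eq_zero fun i _ => Finset.sum_eq_zero fun j _ => ?_
    split_ifs with hij
    · rw [hu (i.succAbove j) i, sub_self]
      rw [f.map_coord_zero (m := Fin.cons (0 : M) fun l => w (i.succAbove (j.succAbove l))) 0
        (Fin.cons_zero _ _), smul_zero]
    · rfl

/-- **One-variable Leibniz rule for a curve of alternating forms evaluated on curves of vectors**: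
if `f : ℝ → F [⋀^ι]→L[ℝ] G` has derivative `f'` at `t` and each `v j` has derivative `v' j` at `t`, then
`s ↦ f s (v · s)` has derivative `f' (v · t) + ∑ j, f t (v · t with v' j in slot j)` at `t`. [folklore] -/
theorem hasDerivAt_continuousAlternatingMap_apply {ι F G : Type*} [Fintype ι] [DecidableEq ι]
    [NormedAddCommGroup F] [NormedSpace ℝ F] [NormedAddCommGroup G] [NormedSpace ℝ G]
    {f : ℝ → F [⋀^ι]→L[ℝ] G} {f' : F [⋀^ι]→L[ℝ] G} {v : ι → ℝ → F} {v' : ι → F} {t : ℝ}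
    (hf : HasDerivAt f f' t) (hv : ∀ j, HasDerivAt (v j) (v' j) t) :
    HasDerivAt (fun s => f s (fun j => v j s))
      (f' (fun j => v j t) + ∑ j, f t (Function.update (fun j => v j t) j (v' j))) t := by
  have h := (hf.hasFDerivAt.continuousAlternatingMap_apply fun j => (hv j).hasFDerivAt).hasDerivAt
  convert h using 1
  simp

variable {n : ℕ} {K : Type} [Field K] [NumberField K]


/-- `g exp(0 • X) = g` in a linear real group over `K_∞`. [folklore] -/
theorem mul_expMem_zero_smul (G : RealMatrixGroup (mixedSpace K) (Fin n)) (g : G.carrier)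
    (X : G.lie) : g * G.expMem ((0 : ℝ) • X) = g :=
  Subtype.ext (Units.ext (by simp))

section MatrixCalculus

/-! Matrix calculus over `K_∞` in the operator norm (a complete normed ring, as the matrix exponential
requires); only this section opens the scope, its exported statements are about hermitian curves. -/

open scoped Matrix.Norms.Operator

/-- **Transfer of derivatives to the hermitian subspace**: a curve `c` in the hermitian space has
derivative `v` as soon as the underlying curve of matrices has derivative `↑v` (`c = P ∘ (↑) ∘ c` for
the continuous linear hermitian-part retraction `P A = ½ (A + Aᴴ)`). [folklore] -/
theorem hasDerivAt_hermSpace_of_coe {c : ℝ → ResGLnCone.hermSpace n K} {v : ResGLnCone.hermSpace n K}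
    {t : ℝ} (h : HasDerivAt (fun s => (c s).1) v.1 t) : HasDerivAt c v t := by
  obtain ⟨P, hP⟩ : ∃ P : Matrix (Fin n) (Fin n) (mixedSpace K) →L[ℝ] ResGLnCone.hermSpace n K,
      ∀ w : ResGLnCone.hermSpace n K, P w.1 = w := by
    refine ⟨LinearMap.toContinuousLinearMap
      { toFun := fun A => ⟨(1 / 2 : ℝ) • (A + Aᴴ), by
          rw [ResGLnCone.mem_hermSpace_iff, Matrix.conjTranspose_smul, Matrix.conjTranspose_add,
            Matrix.conjTranspose_conjTranspose, star_trivial, add_comm]⟩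
        map_add' := fun A B => Subtype.ext (by
          simp only [Matrix.conjTranspose_add, Submodule.coe_add]
          rw [← smul_add]; congr 1; abel)
        map_smul' := fun r A => Subtype.ext (by
          simp only [Matrix.conjTranspose_smul, star_trivial, RingHom.id_apply, Submodule.coe_smul]
          rw [← smul_add, smul_comm]) }, fun w => Subtype.ext ?_⟩
    change (1 / 2 : ℝ) • (w.1 + w.1ᴴ) = w.1
    rw [(ResGLnCone.mem_hermSpace_iff _).1 w.2, ← two_smul ℝ, smul_smul]
    norm_num
  have h2 : HasDerivAt c (P v.1) t :=
    (P.hasFDerivAt.comp_hasDerivAt t h).congr_of_eventuallyEq (.of_forall fun s => (hP (c s)).symm)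
  exact h2.congr_deriv (hP v)

/-- A curve of matrices over `K_∞` with derivative `M'` has a conjugate-transposed curve with
derivative `M'ᴴ` (the conjugate transpose is continuous `ℝ`-linear). [folklore] -/
theorem hasDerivAt_conjTranspose {M : ℝ → Matrix (Fin n) (Fin n) (mixedSpace K)}
    {M' : Matrix (Fin n) (Fin n) (mixedSpace K)} {t : ℝ} (h : HasDerivAt M M' t) :
    HasDerivAt (fun s => (M s)ᴴ) M'ᴴ t := by
  let L : Matrix (Fin n) (Fin n) (mixedSpace K) →L[ℝ] Matrix (Fin n) (Fin n) (mixedSpace K) :=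
    LinearMap.toContinuousLinearMap
      { toFun := fun A => Aᴴ
        map_add' := fun A B => Matrix.conjTranspose_add A B
        map_smul' := fun r A => by rw [Matrix.conjTranspose_smul, star_trivial]; rfl }
  exact L.hasFDerivAt.comp_hasDerivAt t h

/-- **The left-invariant exponential curve `t ↦ g exp(tX)` of a linear real group over `K_∞`, read
in `M_n(K_∞)`, has derivative `g X` at `t = 0`** (`hasDerivAt_exp_smul_const'`). [folklore] -/
theorem hasDerivAt_coe_mul_expMem (G : RealMatrixGroup (mixedSpace K) (Fin n)) (g : G.carrier)
    (X : G.lie) : HasDerivAt (fun t : ℝ => (g * G.expMem (t • X)).1.1) (g.1.1 * X.1) 0 := by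
  have h1 : HasDerivAt (fun s : ℝ => NormedSpace.exp (s • X.1))
      (X.1 * NormedSpace.exp ((0 : ℝ) • X.1)) 0 :=
    hasDerivAt_exp_smul_const' (𝕂 := ℝ) X.1 0
  rw [zero_smul, NormedSpace.exp_zero, mul_one] at h1
  refine (h1.const_mul _).congr_of_eventuallyEq (Eventually.of_forall fun s => ?_)
  simp only [Subgroup.coe_mul, coe_expMem, coe_expGL, Units.val_mul]
  rfl

/-- **The hermitian square along a left-invariant exponential curve**: if `sq h = h hᴴ` then
`t ↦ sq (g exp(tX))` has derivative `v` at `0` for the hermitian `v` with `↑v = g X gᴴ + g Xᴴ gᴴ`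
(product rule and transfer to the hermitian subspace). [folklore] -/
theorem hasDerivAt_sq_mul_expMem (G : RealMatrixGroup (mixedSpace K) (Fin n))
    (sq : G.carrier → ResGLnCone.hermSpace n K) (hsq : ∀ h : G.carrier, (sq h).1 = h.1.1 * h.1.1ᴴ)
    (g : G.carrier) (X : G.lie) (v : ResGLnCone.hermSpace n K)
    (hv : v.1 = g.1.1 * X.1 * g.1.1ᴴ + g.1.1 * X.1ᴴ * g.1.1ᴴ) :
    HasDerivAt (fun t : ℝ => sq (g * G.expMem (t • X))) v 0 := by
  have hM := hasDerivAt_coe_mul_expMem G g X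
  have h1 := (hM.fun_mul (hasDerivAt_conjTranspose hM)).congr_of_eventuallyEq
    (f₁ := fun t : ℝ => (sq (g * G.expMem (t • X))).1) (.of_forall fun t => hsq _)
  rw [mul_expMem_zero_smul] at h1
  refine hasDerivAt_hermSpace_of_coe (h1.congr_deriv ?_)
  rw [hv, Matrix.conjTranspose_mul]
  simp only [mul_assoc]

/-- **The tangent vectors along a left-invariant exponential curve**: if `tg h Z = h Z hᴴ + h Zᴴ hᴴ`
then `t ↦ tg (g exp(tX)) Z` has derivative `u` at `0` for the hermitian `u` with
`↑u = g X Z gᴴ + g Z Xᴴ gᴴ + g X Zᴴ gᴴ + g Zᴴ Xᴴ gᴴ` (two product rules, transfer). [folklore] -/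
theorem hasDerivAt_tg_mul_expMem (G : RealMatrixGroup (mixedSpace K) (Fin n))
    (tg : G.carrier → G.lie → ResGLnCone.hermSpace n K)
    (htg : ∀ (h : G.carrier) (Y : G.lie), (tg h Y).1 = h.1.1 * Y.1 * h.1.1ᴴ + h.1.1 * Y.1ᴴ * h.1.1ᴴ)
    (g : G.carrier) (X Z : G.lie) (u : ResGLnCone.hermSpace n K)
    (hu : u.1 = g.1.1 * X.1 * Z.1 * g.1.1ᴴ + g.1.1 * Z.1 * X.1ᴴ * g.1.1ᴴ + g.1.1 * X.1 * Z.1ᴴ * g.1.1ᴴ +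
      g.1.1 * Z.1ᴴ * X.1ᴴ * g.1.1ᴴ) :
    HasDerivAt (fun t : ℝ => tg (g * G.expMem (t • X)) Z) u 0 := by
  have hM := hasDerivAt_coe_mul_expMem G g X
  have hA := (hM.mul_const Z.1).fun_mul (hasDerivAt_conjTranspose hM)
  have hB := (hM.mul_const Z.1ᴴ).fun_mul (hasDerivAt_conjTranspose hM)
  have h1 := (hA.add hB).congr_of_eventuallyEq
    (f₁ := fun t : ℝ => (tg (g * G.expMem (t • X)) Z).1) (.of_forall fun t => htg _ _)
  rw [mul_expMem_zero_smul] at h1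
  refine hasDerivAt_hermSpace_of_coe (h1.congr_deriv ?_)
  rw [hu, Matrix.conjTranspose_mul]
  noncomm_ring

end MatrixCalculus

set_option maxHeartbeats 800000 in
-- the Leibniz rule on `q + 1` curves of forms and the signed cancellation in one declaration
/-- **Stub LIFT-D — the exterior derivative on the cone read along left-invariant curves on the
group (the dictionary is a cochain map, pointwise).**  For a form `β` on the hermitian space,
differentiable at `g gᴴ`, and HERMITIAN `Y₀, …, Y_q ∈ 𝔤 = 𝔤𝔩_n(K_∞)`, with `sq h = h hᴴ` the hermitian
square and `tg h Y = h Y hᴴ + h Yᴴ hᴴ = dsq_h(h Y)` its differential on the left-invariant field of `Y`: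
`dβ(g gᴴ)(tg g Y₀, …, tg g Y_q) = ∑ᵢ (-1)ⁱ d/dt|₀ [β(sq (g e^{tYᵢ}))(tg (g e^{tYᵢ}) Y₀, …^i…, tg (g e^{tYᵢ}) Y_q)]`
— the invariant formula `dα(Ỹ₀, …, Ỹ_q) = ∑ (-1)ⁱ Ỹᵢ α(…Ỹ̂ᵢ…) + ∑_{i<j} (-1)^{i+j} α([Ỹᵢ, Ỹⱼ], …)` for
`α = sq^* β` and the left-invariant fields `Ỹᵢ`, in which the bracket terms VANISH (`[Yᵢ, Yⱼ]` is
skew-hermitian and `dsq_h(h Z) = h (Z + Zᴴ) hᴴ = 0` for skew `Z`): along `g e^{tYᵢ}` the hermitian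
square has derivative `tg g Yᵢ` and `tg (g e^{tYᵢ}) Y_l` has derivative `2 g (Yᵢ Y_l + Y_l Yᵢ) gᴴ`
at `t = 0`, the Leibniz rule splits each `t`-derivative into the first-order term of `extDeriv` and
slot terms SYMMETRIC in `(i, l)`, which cancel in the signed sum.
[cite: BorelWallach2000, VII 2.2–2.5] -/
theorem stub_extDeriv_hermSquare_leftInvariant {n : ℕ} {K : Type} [Field K] [NumberField K]
    (hcpt : isCompact_glFiniteIntegralLevel n K)
    {V : Type*} [NormedAddCommGroup V] [NormedSpace ℝ V] {q : ℕ}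
    (β : ResGLnCone.hermSpace n K → ResGLnCone.hermSpace n K [⋀^Fin q]→L[ℝ] V)
    (sq : (AutomorphyDatum.gl n K hcpt).arch.carrier → ResGLnCone.hermSpace n K)
    (hsq : ∀ h : (AutomorphyDatum.gl n K hcpt).arch.carrier,
      (sq h : Matrix (Fin n) (Fin n) (mixedSpace K)) =
        ((h : GL (Fin n) (mixedSpace K)) : Matrix (Fin n) (Fin n) (mixedSpace K)) *
          (((h : GL (Fin n) (mixedSpace K)) : Matrix (Fin n) (Fin n) (mixedSpace K)))ᴴ)
    (tg : (AutomorphyDatum.gl n K hcpt).arch.carrier → (AutomorphyDatum.gl n K hcpt).arch.lie →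
      ResGLnCone.hermSpace n K)
    (htg : ∀ (h : (AutomorphyDatum.gl n K hcpt).arch.carrier) (Y : (AutomorphyDatum.gl n K hcpt).arch.lie),
      (tg h Y : Matrix (Fin n) (Fin n) (mixedSpace K)) =
        ((h : GL (Fin n) (mixedSpace K)) : Matrix (Fin n) (Fin n) (mixedSpace K)) *
            (Y : Matrix (Fin n) (Fin n) (mixedSpace K)) *
            (((h : GL (Fin n) (mixedSpace K)) : Matrix (Fin n) (Fin n) (mixedSpace K)))ᴴ +
          ((h : GL (Fin n) (mixedSpace K)) : Matrix (Fin n) (Fin n) (mixedSpace K)) *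
            (Y : Matrix (Fin n) (Fin n) (mixedSpace K))ᴴ *
            (((h : GL (Fin n) (mixedSpace K)) : Matrix (Fin n) (Fin n) (mixedSpace K)))ᴴ)
    (g : (AutomorphyDatum.gl n K hcpt).arch.carrier) (hβ : DifferentiableAt ℝ β (sq g))
    (Y : Fin (q + 1) → (AutomorphyDatum.gl n K hcpt).arch.lie)
    (hY : ∀ i, ((Y i : (AutomorphyDatum.gl n K hcpt).arch.lie) : Matrix (Fin n) (Fin n) (mixedSpace K))ᴴ =
      ((Y i : (AutomorphyDatum.gl n K hcpt).arch.lie) : Matrix (Fin n) (Fin n) (mixedSpace K))) :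
    extDeriv β (sq g) (fun i => tg g (Y i)) =
      ∑ i : Fin (q + 1), (-1 : ℝ) ^ (i : ℕ) •
        deriv (fun t : ℝ => β (sq (g * (AutomorphyDatum.gl n K hcpt).arch.expMem (t • Y i)))
          (fun j => tg (g * (AutomorphyDatum.gl n K hcpt).arch.expMem (t • Y i)) (Y (i.succAbove j)))) 0 := by
  set gm : Matrix (Fin n) (Fin n) (mixedSpace K) := g.1.1 with hgm
  -- the symmetric second-order terms `U a b = 2 g (Y_a Y_b + Y_b Y_a) gᴴ` (hermitian)
  have hUmem : ∀ a b : Fin (q + 1), gm * ((Y a).1 * (Y b).1 + (Y b).1 * (Y a).1) * gmᴴ +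
      gm * ((Y a).1 * (Y b).1 + (Y b).1 * (Y a).1) * gmᴴ ∈ ResGLnCone.hermSpace n K := by
    intro a b
    rw [ResGLnCone.mem_hermSpace_iff]
    simp only [Matrix.conjTranspose_add, Matrix.conjTranspose_mul, Matrix.conjTranspose_conjTranspose,
      hY a, hY b]
    noncomm_ring
  set U : Fin (q + 1) → Fin (q + 1) → ResGLnCone.hermSpace n K := fun a b => ⟨_, hUmem a b⟩ with hU_def
  have hU : ∀ a b, U a b = U b a := fun a b =>
    Subtype.ext (by simp only [hU_def]; rw [add_comm ((Y a).1 * _)])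
  -- (1) the hermitian squares `t ↦ sq (g exp(tYᵢ))` have derivative `tg g Yᵢ` at `0`
  have hc : ∀ i : Fin (q + 1), HasDerivAt
      (fun t : ℝ => sq (g * (AutomorphyDatum.gl n K hcpt).arch.expMem (t • Y i))) (tg g (Y i)) 0 :=
    fun i => hasDerivAt_sq_mul_expMem _ sq hsq g (Y i) (tg g (Y i)) (htg g (Y i))
  -- (2) the tangent vectors `t ↦ tg (g exp(tYᵢ)) Y_l` have derivative `U i l` at `0`
  have hw : ∀ (i l : Fin (q + 1)), HasDerivAt
      (fun t : ℝ => tg (g * (AutomorphyDatum.gl n K hcpt).arch.expMem (t • Y i)) (Y l)) (U i l) 0 := by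
    intro i l
    refine hasDerivAt_tg_mul_expMem _ tg htg g (Y i) (Y l) (U i l) ?_
    simp only [hU_def]
    rw [← hgm, hY i, hY l]
    noncomm_ring
  -- (3) the Leibniz rule along each curve
  have key : ∀ i : Fin (q + 1), HasDerivAt
      (fun t : ℝ => β (sq (g * (AutomorphyDatum.gl n K hcpt).arch.expMem (t • Y i)))
        (fun j => tg (g * (AutomorphyDatum.gl n K hcpt).arch.expMem (t • Y i)) (Y (i.succAbove j))))
      (fderiv ℝ β (sq g) (tg g (Y i)) (fun j => tg g (Y (i.succAbove j))) +
        ∑ j : Fin q, β (sq g) (Function.update (fun j => tg g (Y (i.succAbove j))) j (U i (i.succAbove j)))) 0 := by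
    intro i
    have hβc : HasDerivAt (fun t : ℝ => β (sq (g * (AutomorphyDatum.gl n K hcpt).arch.expMem (t • Y i))))
        (fderiv ℝ β (sq g) (tg g (Y i))) 0 :=
      hβ.hasFDerivAt.comp_hasDerivAt_of_eq 0 (hc i) (by rw [mul_expMem_zero_smul])
    have h := hasDerivAt_continuousAlternatingMap_apply hβc (fun j => hw i (i.succAbove j))
    rwa [mul_expMem_zero_smul] at h
  -- (4) sum over `i`: the first-order terms give `dβ`, the symmetric second-order terms cancel
  have hcancel : ∑ i : Fin (q + 1), (-1 : ℝ) ^ (i : ℕ) • ∑ j : Fin q,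
      β (sq g) (Function.update (fun l => tg g (Y (i.succAbove l))) j (U i (i.succAbove j))) = 0 := by
    simpa only [ContinuousAlternatingMap.coe_toAlternatingMap] using
      sum_neg_one_pow_smul_sum_map_update_eq_zero_of_symm (β (sq g)).toAlternatingMap
        (fun l => tg g (Y l)) U hU
  calc extDeriv β (sq g) (fun i => tg g (Y i))
      = ∑ i : Fin (q + 1), (-1 : ℝ) ^ (i : ℕ) •
          (fderiv ℝ β (sq g) (tg g (Y i)) (fun j => tg g (Y (i.succAbove j))) +
            ∑ j : Fin q, β (sq g) (Function.update (fun j => tg g (Y (i.succAbove j))) j (U i (i.succAbove j)))) := by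
        simp only [smul_add, Finset.sum_add_distrib, hcancel, add_zero]
        rw [extDeriv, ContinuousAlternatingMap.alternatizeUncurryFin_apply]
        refine Finset.sum_congr rfl fun i _ => ?_
        rw [liftD_neg_one_pow_zsmul_eq (R := ℝ)]
        rfl
    _ = _ := Finset.sum_congr rfl fun i _ => by rw [(key i).deriv]

end Summit.Langlands.Langlands.Theorems.HeckeEigenvalueField.Res

end
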